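import Summits.CriticalPhenomena.SAWScalingLimit.Theses.SAWTwistedSelfEnergy
import Literature.NumberTheory.LFunctions.KaramataTauberian

/-!
# Line `abel-littlewood` for crux `TwistedGapEquation` (stmt-CriticalPhenomena-17874) — typed against the
# REPAIRED statement R1 (crux-strategist, 2026-08-17)

Route `SAWTwistedSelfEnergy` of `CriticalPhenomena/SAWScalingLimit`, crux rank 4 ("criticality of the `ℤ²` SAW is
the gap equation of the twisted resolvent in the spin sector").  AS TYPED the crux is refuted
(`Cruxes/TwistedGapEquation/Misstatement.lean`: the `n = 0` slice `K 0 0` of the kernel is free, so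
`TwistedGapEquation ↔ ∀ K, ¬ IsTwistedKernel K`); like `BirthRepaired.lean` this file therefore targets
`TwistedGapEquationR` = the route's signature with `K 0 = 0 ∧` prepended to the `IsTwistedKernel` let (repair R1 of
`MISSTATED.md`, same decl name after `ledger route edit … --restate`).  After the restate replace `TwistedGapEquationR`
by `Summit.CriticalPhenomena.SAWScalingLimit.Theses.SAWTwistedSelfEnergy.TwistedGapEquation` in § 4 (three
occurrences) and delete the local `def`; nothing else changes (`repaired_iff` stays `Iff.rfl`).

## The line — DECOUPLE the gap equation from absolute summability of the kernel

Notation: `κ_n := Σ_z Σ_k K_n(z)(E,k) i^k` (spin-sector zero-momentum coefficient of the kernel), `g_n := Σ_z Σ_k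
G_n(z)(E,k) i^k = Σ_ω e^{i(3/8)W(ω)}` (twisted count of `n`-step SAWs not starting West), `χ(x) = Σ g_n x^n`,
`k(x) = Σ κ_n x^n`, `λ₁ = 1 + 2cos(3π/16)`.  The birth line (A ⊕ B ⊕ C) makes the crux ride on A = "`Σ x_c^n|κ_n| < ∞`",
the zero-momentum shadow of the rank-2 crux `TwistedKernelSummable` — whose fate is genuinely uncertain (ℓ¹ effective
exponent `0.77 < 1` at `n = 14`).  This line removes that dependence: Abel summability of `Σ κ_n x_c^n` to the gap value
needs only B and C, and the passage Abel ⇒ convergence is LITTLEWOOD's Tauberian theorem under the term bound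
`κ_n x_c^n = O(1/n)` — a pointwise, cancellation-friendly condition on ONE scalar sequence (strategist numerics, exact
enumeration to `n = 30`, kit j024699: `n·|κ_n| x_c^n ≤ 0.147`, attained at `n = 5`, decreasing to `0.047` at `n = 30`; the smooth
part of `κ_n x_c^n` decays like `n^{-33/16}` and the `ℤ²`-bipartite alternating part like `n^{-1.55}`).

* `stub_spinResolventIdentity` (B; M/L, provable now; IDENTICAL to the birth line's stub B, one proof serves both):
  for `0 < x < x_c`, if `Σ |κ_n| x^n < ∞` then `Σ |g_n| x^n < ∞` and `χ(x)·(1 − xλ₁ − k(x)) = 1`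
  (90°-rotation covariance ⇒ scalar renewal equation `g_n = λ₁ g_{n−1} + Σ_{m=1}^n κ_m g_{n−m}`; radius from `|g_n| ≤ c_n`).
* `stub_spinSusceptibilityDiverges` (C; research-open; IDENTICAL to the birth line's stub C): `‖χ(x)‖ → ∞` as `x ↑ x_c`.
* `stub_kernelTauberianBound` (T; research-open, NEW): `∃ A, ∀ n ≥ 1, |κ_n| x_c^n ≤ A/n`.
* `littlewoodTauberian` (L; PROVED in this file, no `sorry`, from the tree's Hardy–Littlewood–Karamata theorem
  `Literature.NumberTheory.LFunctions.HardyLittlewoodTauberianSums_holds` with `λ_n = n`, `β = 0`, `w_n = |c_n|`, applied to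
  real and imaginary parts): a complex sequence with `a_n = O(1/n)` that is Abel-summable to `s` converges to `s`.
* `TwistedGapEquationR_of` (kernel-checked, no `sorry`; THREE stub hypotheses B, C, T): T ⇒ `Σ|κ_n|x^n < ∞` below `x_c` (geometric domination) ⇒ (B)
  `k(x) = 1 − xλ₁ − χ(x)⁻¹` on `(0,x_c)` ⇒ (C) `k(x) → 1 − x_cλ₁` along `𝓝[<] x_c`; the substitution `x = r·x_c` makes
  this Abel summability of `a_n = x_c^n κ_n` along `𝓝[<] 1`; (L) with (T) gives convergence of `Σ_{n≤N} a_n`, the crux.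

No stub is the crux, the summit, or a refuted statement: B is an identity below `x_c` conditional on summability, C and
T carry no limit VALUE, L is a theorem of analysis.  Honours `Misstatement.twistedGapEquation_false`: the predicate
has `K 0 = 0`; none of B/C/T/L can see a free `K 0 0` (L and the composition treat `a_0` uniformly on both sides).
-/

noncomputable section

open Filter Topology Set
open scoped BigOperators Topology Classical Matrix
open Literature.Probability.RandomPlanarGeometry Literature.Probability.LatticeModels

namespace Summit.CriticalPhenomena.SAWScalingLimit.Cruxes.TwistedGapEquation.AbelLittlewood

/-! ### 1. Vocabulary: the route's shared `let` block, named (letter for letter; same as `BirthRepaired.lean`) -/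

/-- the four lattice directions `E, N, W, S` (the route's `let dir`) -/
def dir : Fin 4 → Site 2 := ![![1, 0], ![0, 1], ![-1, 0], ![0, -1]]

/-- the spin `σ = 5/8` (the route's `let σ`) -/
def spin : ℝ := 5 / 8

/-- the one-step twisted non-backtracking matrix `T` (the route's `let T`) -/
def stepMatrix : Matrix (Fin 4) (Fin 4) ℂ := fun a b =>
  if dir b = -dir a then 0 else
    Complex.exp (-Complex.I * spin *
      (turning (-Site.toComplex (dir a)) 0 (Site.toComplex (dir b)) : ℝ))

/-- the twisted two-point matrices `G n z` (the route's `let G`) -/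
def twoPoint : ℕ → Site 2 → Matrix (Fin 4) (Fin 4) ℂ := fun n z ι κ =>
  if n = 0 then (if z = 0 ∧ ι = κ then 1 else 0) else
    ∑ p ∈ ((zdGraph 2).finsetWalkLength n (0 : Site 2) z).filter (fun p => p.IsPath),
      (if p.getVert 1 = -dir ι ∨ z - p.getVert (n - 1) ≠ dir κ then 0 else
        Complex.exp (-Complex.I * spin *
          (winding ((-Site.toComplex (dir ι)) :: (p.support.map Site.toComplex)) : ℝ)))

/-- **REPAIRED** kernel predicate (R1): the route's `let IsTwistedKernel` with the clause `K 0 = 0` prepended. -/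
def IsTwistedKernel (K : ℕ → Site 2 → Matrix (Fin 4) (Fin 4) ℂ) : Prop :=
  K 0 = 0 ∧ (∀ n z, z ∉ box 2 n → K n z = 0) ∧
  (∀ n, 1 ≤ n → ∀ z, twoPoint n z =
    Matrix.of (fun ι κ => ∑ κ' : Fin 4, twoPoint (n - 1) (z - dir κ) ι κ' * stepMatrix κ' κ) +
      ∑ m ∈ Finset.Icc 1 n, ∑ y ∈ box 2 m, K m y * twoPoint (n - m) (z - y))

/-- `κ_n`: spin-sector (weights `i^k`) zero-momentum coefficient of the kernel at length `n` -/
def kerCoeff (K : ℕ → Site 2 → Matrix (Fin 4) (Fin 4) ℂ) (n : ℕ) : ℂ :=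
  ∑ z ∈ box 2 n, ∑ k : Fin 4, K n z 0 k * Complex.I ^ (k : ℕ)

/-- `g_n`: spin-sector zero-momentum coefficient of the twisted two-point matrix at length `n` -/
def twoPointCoeff (n : ℕ) : ℂ :=
  ∑ z ∈ box 2 n, ∑ k : Fin 4, twoPoint n z 0 k * Complex.I ^ (k : ℕ)

/-- `λ₁ = 1 + 2 cos(3π/16) = Σ_k T(E,k) i^k`, the spin-sector eigenvalue of `T` -/
def lam1 : ℝ := 1 + 2 * Real.cos (3 * Real.pi / 16)

/-- `k(x) = Σ_n κ_n x^n` -/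
def kerGF (K : ℕ → Site 2 → Matrix (Fin 4) (Fin 4) ℂ) (x : ℝ) : ℂ :=
  ∑' n : ℕ, (x : ℂ) ^ n * kerCoeff K n

/-- `χ(x) = Σ_n g_n x^n`, the spin-sector twisted susceptibility -/
def chiGF (x : ℝ) : ℂ :=
  ∑' n : ℕ, (x : ℂ) ^ n * twoPointCoeff n

/-- the crux's partial sums `Σ_{n ≤ N} x_c^n κ_n` -/
def partialSum (K : ℕ → Site 2 → Matrix (Fin 4) (Fin 4) ℂ) (N : ℕ) : ℂ :=
  ∑ n ∈ Finset.range (N + 1), (SAW.criticalFugacity : ℂ) ^ n * kerCoeff K n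

/-- the gap-equation value `1 − x_c λ₁` -/
def gapValue : ℂ := 1 - (SAW.criticalFugacity : ℂ) * ((lam1 : ℝ) : ℂ)

/-- **The repaired crux `C′`** (repair R1 of `MISSTATED.md`, the `--restate` text for `TwistedGapEquation`). -/
def TwistedGapEquationR : Prop :=
  let dir : Fin 4 → Literature.Probability.LatticeModels.Site 2 := ![![1, 0], ![0, 1], ![-1, 0], ![0, -1]]; let σ : ℝ := 5 / 8; let T : Matrix (Fin 4) (Fin 4) ℂ := fun a b => if dir b = -dir a then 0 else Complex.exp (-Complex.I * σ * (Literature.Probability.LatticeModels.turning (-Literature.Probability.LatticeModels.Site.toComplex (dir a)) 0 (Literature.Probability.LatticeModels.Site.toComplex (dir b)) : ℝ)); let G : ℕ → Literature.Probability.LatticeModels.Site 2 → Matrix (Fin 4) (Fin 4) ℂ := fun n z ι κ => if n = 0 then (if z = 0 ∧ ι = κ then 1 else 0) else ∑ p ∈ ((Literature.Probability.LatticeModels.zdGraph 2).finsetWalkLength n (0 : Literature.Probability.LatticeModels.Site 2) z).filter (fun p => p.IsPath), (if p.getVert 1 = -dir ι ∨ z - p.getVert (n - 1) ≠ dir κ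 then 0 else Complex.exp (-Complex.I * σ * (Literature.Probability.LatticeModels.winding ((-Literature.Probability.LatticeModels.Site.toComplex (dir ι)) :: (p.support.map Literature.Probability.LatticeModels.Site.toComplex)) : ℝ))); let IsTwistedKernel : (ℕ → Literature.Probability.LatticeModels.Site 2 → Matrix (Fin 4) (Fin 4) ℂ) → Prop := fun K => K 0 = 0 ∧ (∀ n z, z ∉ Literature.Probability.LatticeModels.box 2 n → K n z = 0) ∧ (∀ n, 1 ≤ n → ∀ z, G n z = Matrix.of (fun ι κ => ∑ κ' : Fin 4, G (n - 1) (z - dir κ) ι κ' * T κ' κ) + ∑ m ∈ Finset.Icc 1 n, ∑ y ∈ Literature.Probability.LatticeModels.box 2 m, K m y * G (n - m) (z - y)); ∀ K : ℕ → Literature.Probability.LatticeModels.Site 2 → Matrix (Fin 4) (Fin 4) ℂ, IsTwistedKernel K → Filter.Tendsto (fun N : ℕ => ∑ n ∈ Finset.range (N + 1), (Literature.Probability.RandomPlanarGeometry.SAW.criticalFugacity : ℂ) ^ n * ∑ z ∈ Literature.Probability.LatticeModels.box 2 n, ∑ k : Fin 4, K n z 0 k * Complex.I ^ (k : ℕ))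 Filter.atTop (nhds (1 - (Literature.Probability.RandomPlanarGeometry.SAW.criticalFugacity : ℂ) * ((1 + 2 * Real.cos (3 * Real.pi / 16) : ℝ) : ℂ)))

/-- Sanity (definitional): the repaired crux over the named vocabulary. -/
theorem repaired_iff :
    TwistedGapEquationR ↔ ∀ K, IsTwistedKernel K → Tendsto (partialSum K) atTop (𝓝 gapValue) :=
  Iff.rfl

/-! ### 2. The three stub statements (B, C, T) and the Tauberian statement L (proved in § 3b) -/

/-- STUB B statement — **subcritical spin-sector resolvent identity** (same statement as the birth line's B). -/
def SpinResolventIdentity : Prop :=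
  ∀ K, IsTwistedKernel K → ∀ x : ℝ, 0 < x → x < SAW.criticalFugacity →
    Summable (fun n : ℕ => x ^ n * ‖kerCoeff K n‖) →
      Summable (fun n : ℕ => x ^ n * ‖twoPointCoeff n‖) ∧
        chiGF x * (1 - (x : ℂ) * ((lam1 : ℝ) : ℂ) - kerGF K x) = 1

/-- STUB C statement — **the spin-`3/8`-twisted susceptibility diverges at `x_c`** (same statement as birth's C). -/
def SpinSusceptibilityDiverges : Prop :=
  Tendsto (fun x : ℝ => ‖chiGF x‖) (𝓝[<] SAW.criticalFugacity) atTop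

/-- STUB T statement — **Tauberian term bound**: `κ_n x_c^n = O(1/n)`. -/
def KernelTauberianBound : Prop :=
  ∀ K, IsTwistedKernel K → ∃ A : ℝ, ∀ n : ℕ, 1 ≤ n → ‖kerCoeff K n‖ * SAW.criticalFugacity ^ n ≤ A / n

/-- Statement L — **Littlewood's Tauberian theorem** (power-series form, complex terms): if `a_n = O(1/n)` and
`Σ a_n r^n → s` as `r ↑ 1`, then `Σ_{n ≤ N} a_n → s`.  PROVED below (`littlewoodTauberian`), not a stub. -/
def LittlewoodTauberian : Prop :=
  ∀ (a : ℕ → ℂ) (s : ℂ), (∃ A : ℝ, ∀ n : ℕ, 1 ≤ n → ‖a n‖ ≤ A / n) →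
    Tendsto (fun r : ℝ => ∑' n : ℕ, (r : ℂ) ^ n * a n) (𝓝[<] 1) (𝓝 s) →
      Tendsto (fun N : ℕ => ∑ n ∈ Finset.range (N + 1), a n) atTop (𝓝 s)

-- END OF STATEMENTS

/-! ### 3. The registered stubs (the only `sorry`s of the file) -/

/-- STUB B (M/L, provable now): see `BirthRepaired.lean`; exact lattice symmetry (rotation by `i` is a bijection of
`n`-step SAWs preserving all turning angles and shifting direction labels) makes `Ĝ_n(0)`, `K̂_n(0)` circulant, so the
spin vector `(i^k)_k` is a joint eigenvector and the matrix recursion becomes the scalar renewal equation; Cauchy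
product below the common radius `x_c` (`|g_n| ≤ c_n`, `SAW.Zd.tendsto_count_rpow`).  Why it might fail: only by a
convention slip — all conventions were replicated by exact enumeration (refuter review; strategist `exp/gap.py`,
`Z[ζ₃₂]`-exact to `n = 30`, where `χ_j = 1/(1 − x λ_j − k_j)` is also visible numerically in the non-critical sectors). -/
theorem stub_spinResolventIdentity : SpinResolventIdentity := by
  sorry

/-- STUB C (research-open): divergence of the spin-`3/8`-twisted susceptibility at `x_c`.  Why plausibly true:
CFT gives `g_n ≍ μ^n n^{γ₁−1}` with `γ₁ = 17/16 > 0` (dimension `7/24` of the spin-`3/8` one-leg operator), and exact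
enumeration shows `x_c^n g_n` INCREASING (`1.009 → 1.183`, `n = 1..30`, local exponent `0.05 ≈ 1/16`) with
`E_n[cos(3W/8)] = 0.41 > 0` at `n = 30`; bridges alone (winding `∈ {0, ±π/2}`) contribute `≥ cos(3π/16)·B(x) → ∞`.
Why it might fail (as a proof target): no rigorous control of SAW windings; the non-bridge signed remainder is not
dominated by any known positive quantity. -/
theorem stub_spinSusceptibilityDiverges : SpinSusceptibilityDiverges := by
  sorry

/-- STUB T (research-open, NEW): `n·|κ_n|·x_c^n` is bounded.  Why plausibly true: `k(x) = 1 − xλ₁ − χ(x)⁻¹` with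
`χ(x)⁻¹ ≍ (x_c − x)^{17/16}` gives a smooth part `≍ n^{−33/16}` and the bipartite singularity at `−x_c` an alternating
part, measured `≍ n^{−1.56}`; exact enumeration: `sup_{n ≤ 30} n|κ_n|x_c^n = 0.147` (at `n = 5`), `0.047` at `n = 30`.
Why it might fail: a stronger-than-expected singularity of the spin-sector symbol on `|x| = x_c` away from `x_c`
(only `±x_c` are expected for `ℤ²`); note it is NOT implied by, and does not imply, `TwistedKernelSummable`. -/
theorem stub_kernelTauberianBound : KernelTauberianBound := by
  sorry

/-! ### Name-keyed aliases of the stub statements (hypotheses of the composition) -/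
namespace Registered

/-- Alias keyed by the registered stub name. -/
abbrev stub_spinResolventIdentity : Prop := SpinResolventIdentity
/-- Alias keyed by the registered stub name. -/
abbrev stub_spinSusceptibilityDiverges : Prop := SpinSusceptibilityDiverges
/-- Alias keyed by the registered stub name. -/
abbrev stub_kernelTauberianBound : Prop := KernelTauberianBound
end Registered

/-! ### 3b. Littlewood's Tauberian theorem, PROVED from the tree's Hardy–Littlewood–Karamata theorem (MV Thm 5.7) -/
namespace Tauber

open Literature.NumberTheory.LFunctions

/-- Littlewood, real terms, Abel limit `0`. -/
theorem littlewood_real_zero (c : ℕ → ℝ) (A : ℝ) (hA : ∀ n : ℕ, 1 ≤ n → |c n| ≤ A / n)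
    (habel : Tendsto (fun r : ℝ => ∑' n : ℕ, c n * r ^ n) (𝓝[<] 1) (𝓝 0)) :
    Tendsto (fun N : ℕ => ∑ n ∈ Finset.range (N + 1), c n) atTop (𝓝 0) := by
  -- `A ≥ 0` and a uniform bound `M` on `|c n|`
  have hA0 : 0 ≤ A := by
    have h := hA 1 le_rfl
    simp only [Nat.cast_one, div_one] at h
    exact (abs_nonneg _).trans h
  set M : ℝ := |c 0| + A with hM
  have hcM : ∀ n, |c n| ≤ M := by
    intro n
    rcases Nat.eq_zero_or_pos n with rfl | hn
    · simp only [hM]; linarith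
    · have h1 := hA n hn
      have h2 : A / n ≤ A := div_le_self hA0 (by exact_mod_cast hn)
      linarith [abs_nonneg (c 0)]
  have hexp_eq : ∀ (δ : ℝ) (n : ℕ), Real.exp (-(δ * n)) = Real.exp (-δ) ^ n := by
    intro δ n
    rw [← Real.exp_nat_mul]; congr 1; ring
  -- summability of `|c n| e^{-δ n}` and `c n e^{-δ n}` for `δ > 0`
  have hsw : ∀ δ : ℝ, 0 < δ → Summable fun n : ℕ => |c n| * Real.exp (-(δ * n)) := by
    intro δ hδ
    have hq1 : Real.exp (-δ) < 1 := by rw [Real.exp_lt_one_iff]; linarith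
    refine Summable.of_nonneg_of_le (fun n => by positivity) (fun n => ?_)
      ((summable_geometric_of_lt_one (Real.exp_pos _).le hq1).mul_left M)
    rw [hexp_eq]
    exact mul_le_mul_of_nonneg_right (hcM n) (pow_nonneg (Real.exp_pos _).le n)
  have hsc : ∀ δ : ℝ, 0 < δ → Summable fun n : ℕ => c n * Real.exp (-(δ * n)) := by
    intro δ hδ
    refine Summable.of_norm ?_
    have : (fun n : ℕ => ‖c n * Real.exp (-(δ * n))‖) = fun n => |c n| * Real.exp (-(δ * n)) := by
      funext n
      rw [Real.norm_eq_abs, abs_mul, abs_of_pos (Real.exp_pos _)]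
    rw [this]
    exact hsw δ hδ
  -- (h3) Abel hypothesis in the variable `δ = -log r`
  have hsubst : Tendsto (fun δ : ℝ => Real.exp (-δ)) (𝓝[>] 0) (𝓝[<] 1) := by
    refine tendsto_nhdsWithin_iff.2 ⟨?_, ?_⟩
    · have h : Tendsto (fun δ : ℝ => Real.exp (-δ)) (𝓝 0) (𝓝 (Real.exp (-0))) :=
        (Real.continuous_exp.comp continuous_neg).tendsto 0
      simp only [neg_zero, Real.exp_zero] at h
      exact h.mono_left nhdsWithin_le_nhds
    · filter_upwards [self_mem_nhdsWithin] with δ hδ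
      rw [mem_Iio, Real.exp_lt_one_iff]
      simpa using hδ
  have habel' : Tendsto (fun δ : ℝ => δ ^ (0 : ℝ) * ∑' n : ℕ, c n * Real.exp (-(δ * n)))
      (𝓝[>] 0) (𝓝 0) := by
    have key : (fun δ : ℝ => δ ^ (0 : ℝ) * ∑' n : ℕ, c n * Real.exp (-(δ * n))) =
        fun δ => ∑' n : ℕ, c n * Real.exp (-δ) ^ n := by
      funext δ
      rw [Real.rpow_zero, one_mul]
      exact tsum_congr (fun n => by rw [hexp_eq])
    rw [key]
    exact habel.comp hsubst
  -- the constant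
  set C : ℝ := 3 * A * Real.exp 1 + 1 with hC
  have he1 : (1 : ℝ) ≤ Real.exp 1 := by
    have := Real.add_one_le_exp (1 : ℝ); linarith
  -- (h4) first weight estimate
  have h4 : ∀ᶠ U : ℝ in atTop, ∑' n : ℕ, |c n| * (Real.exp (-((n : ℝ) / U)) *
      (1 - Real.exp (-((n : ℝ) / U)))) ≤ C * U ^ (0 : ℝ) := by
    filter_upwards [eventually_ge_atTop (1 : ℝ)] with U hU
    rw [Real.rpow_zero, mul_one]
    have hU0 : 0 < U := by linarith
    set q : ℝ := Real.exp (-(1 / U)) with hq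
    have hq0 : 0 ≤ q := (Real.exp_pos _).le
    have hq1 : q < 1 := by
      rw [hq, Real.exp_lt_one_iff]
      have : 0 < 1 / U := by positivity
      linarith
    have hqn : ∀ n : ℕ, Real.exp (-((n : ℝ) / U)) = q ^ n := by
      intro n
      rw [hq, ← Real.exp_nat_mul]; congr 1; ring
    have h1mexp : ∀ n : ℕ, 0 ≤ 1 - Real.exp (-((n : ℝ) / U)) := by
      intro n
      rw [sub_nonneg, Real.exp_le_one_iff]
      have : (0 : ℝ) ≤ n / U := by positivity
      linarith
    have hterm : ∀ n : ℕ, |c n| * (Real.exp (-((n : ℝ) / U)) * (1 - Real.exp (-((n : ℝ) / U)))) ≤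
        A / U * q ^ n := by
      intro n
      rcases Nat.eq_zero_or_pos n with rfl | hn
      · have h0 : |c 0| * (Real.exp (-(((0 : ℕ) : ℝ) / U)) * (1 - Real.exp (-(((0 : ℕ) : ℝ) / U)))) = 0 := by
          simp
        rw [h0, pow_zero, mul_one]
        exact div_nonneg hA0 hU0.le
      · have h1 : 1 - Real.exp (-((n : ℝ) / U)) ≤ (n : ℝ) / U := by
          have := Real.add_one_le_exp (-((n : ℝ) / U))
          linarith
        have hcn : |c n| ≤ A / n := hA n hn
        have hnpos : (0 : ℝ) < n := by exact_mod_cast hn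
        calc |c n| * (Real.exp (-((n : ℝ) / U)) * (1 - Real.exp (-((n : ℝ) / U))))
            ≤ (A / n) * (Real.exp (-((n : ℝ) / U)) * ((n : ℝ) / U)) := by
              exact mul_le_mul hcn (mul_le_mul_of_nonneg_left h1 (Real.exp_pos _).le)
                (mul_nonneg (Real.exp_pos _).le (h1mexp n)) (div_nonneg hA0 n.cast_nonneg)
          _ = A / U * q ^ n := by
              rw [hqn n]; field_simp
    have hsum_geom : Summable (fun n : ℕ => A / U * q ^ n) :=
      (summable_geometric_of_lt_one hq0 hq1).mul_left _
    have hsum_lhs : Summable (fun n : ℕ => |c n| * (Real.exp (-((n : ℝ) / U)) *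
        (1 - Real.exp (-((n : ℝ) / U))))) :=
      Summable.of_nonneg_of_le (fun n => by have := h1mexp n; positivity) hterm hsum_geom
    -- `1 - q ≥ e^{-1} / U`
    have hq_lb : Real.exp (-1) / U ≤ 1 - q := by
      have h1 : 1 / U + 1 ≤ Real.exp (1 / U) := Real.add_one_le_exp _
      have hle1 : 1 / U ≤ 1 := by rw [div_le_one hU0]; exact hU
      have h2 : Real.exp (-1) ≤ Real.exp (-(1 / U)) := Real.exp_le_exp.2 (by linarith)
      have h3 : 1 - q = (Real.exp (1 / U) - 1) * Real.exp (-(1 / U)) := by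
        rw [hq, sub_mul, ← Real.exp_add, add_neg_cancel, Real.exp_zero, one_mul]
      rw [h3]
      have h4' : 0 < 1 / U := by positivity
      calc Real.exp (-1) / U = (1 / U) * Real.exp (-1) := by ring
        _ ≤ (Real.exp (1 / U) - 1) * Real.exp (-(1 / U)) := by
          apply mul_le_mul (by linarith) h2 (Real.exp_pos _).le (by linarith)
    have hpos : 0 < Real.exp (-1) / U := by positivity
    calc ∑' n : ℕ, |c n| * (Real.exp (-((n : ℝ) / U)) * (1 - Real.exp (-((n : ℝ) / U))))
        ≤ ∑' n : ℕ, A / U * q ^ n := hsum_lhs.tsum_le_tsum hterm hsum_geom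
      _ = A / U * (1 - q)⁻¹ := by rw [tsum_mul_left, tsum_geometric_of_lt_one hq0 hq1]
      _ ≤ A / U * (Real.exp (-1) / U)⁻¹ := by
          apply mul_le_mul_of_nonneg_left _ (by positivity)
          exact inv_anti₀ hpos hq_lb
      _ = A / U * (U * Real.exp 1) := by rw [inv_div, Real.exp_neg, div_inv_eq_mul]
      _ = A * Real.exp 1 := by rw [← mul_assoc, div_mul_cancel₀ _ hU0.ne']
      _ ≤ C := by
          rw [hC]
          have := mul_nonneg hA0 (Real.exp_pos 1).le
          linarith
  -- (h5) second weight estimate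
  have h5 : ∀ ε : ℝ, 0 < ε → ε < 1 / 4 → ∀ᶠ U : ℝ in atTop,
      ∑' n : ℕ, (if (1 - ε) * U ≤ (n : ℝ) ∧ (n : ℝ) ≤ (1 + ε) * U then |c n| else 0) ≤
        C * ε * U ^ (0 : ℝ) := by
    intro ε hε hε4
    filter_upwards [eventually_ge_atTop (max 2 (1 / ε))] with U hU
    have hU2 : 2 ≤ U := le_trans (le_max_left _ _) hU
    have hUε : 1 / ε ≤ U := le_trans (le_max_right _ _) hU
    have hU0 : 0 < U := by linarith
    have hεU : 1 ≤ ε * U := by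
      rw [div_le_iff₀ hε] at hUε; linarith
    rw [Real.rpow_zero, mul_one]
    set f : ℕ → ℝ := fun n => if (1 - ε) * U ≤ (n : ℝ) ∧ (n : ℝ) ≤ (1 + ε) * U then |c n| else 0
      with hf
    set S : Finset ℕ := Finset.Icc ⌈(1 - ε) * U⌉₊ ⌊(1 + ε) * U⌋₊ with hS
    have hsupp : ∀ n ∉ S, f n = 0 := by
      intro n hn
      rw [hf]; dsimp only
      rw [if_neg]
      rintro ⟨h1, h2⟩
      apply hn
      rw [hS, Finset.mem_Icc]
      exact ⟨Nat.ceil_le.2 h1, Nat.le_floor h2⟩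
    rw [tsum_eq_sum hsupp]
    have hbound : ∀ n ∈ S, f n ≤ 2 * A / U := by
      intro n _
      rw [hf]; dsimp only
      split_ifs with h
      · obtain ⟨h1, h2⟩ := h
        have h34 : 3 / 4 ≤ 1 - ε := by linarith
        have hprod : 1 ≤ (1 - ε) * U := by
          have : (3 / 4 : ℝ) * 2 ≤ (1 - ε) * U := mul_le_mul h34 hU2 (by norm_num) (by linarith)
          linarith
        have hn1 : (1 : ℝ) ≤ n := le_trans hprod h1
        have hn1' : 1 ≤ n := by exact_mod_cast hn1
        have hdenpos : 0 < (1 - ε) * U := by positivity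
        calc |c n| ≤ A / n := hA n hn1'
          _ ≤ A / ((1 - ε) * U) := div_le_div_of_nonneg_left hA0 hdenpos h1
          _ ≤ 2 * A / U := by
            rw [div_le_div_iff₀ hdenpos hU0]
            have key : 0 ≤ A * U * (1 - 2 * ε) := mul_nonneg (mul_nonneg hA0 hU0.le) (by linarith)
            have : 2 * A * ((1 - ε) * U) - A * U = A * U * (1 - 2 * ε) := by ring
            linarith
      · positivity
    have hcard : (S.card : ℝ) ≤ 3 * ε * U := by
      rw [hS, Nat.card_Icc]
      have h1 : (⌊(1 + ε) * U⌋₊ : ℝ) ≤ (1 + ε) * U := Nat.floor_le (by positivity)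
      have h2 : (1 - ε) * U ≤ (⌈(1 - ε) * U⌉₊ : ℝ) := Nat.le_ceil _
      by_cases hle : ⌈(1 - ε) * U⌉₊ ≤ ⌊(1 + ε) * U⌋₊ + 1
      · rw [Nat.cast_sub hle]
        push_cast
        linarith
      · rw [Nat.sub_eq_zero_of_le (le_of_lt (not_le.1 hle))]
        simp only [CharP.cast_eq_zero]
        positivity
    calc ∑ n ∈ S, f n ≤ S.card • (2 * A / U) := Finset.sum_le_card_nsmul S f _ hbound
      _ = (S.card : ℝ) * (2 * A / U) := by rw [nsmul_eq_mul]
      _ ≤ 3 * ε * U * (2 * A / U) :=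
          mul_le_mul_of_nonneg_right hcard (div_nonneg (mul_nonneg zero_le_two hA0) hU0.le)
      _ = 6 * A * ε := by
          rw [show 3 * ε * U * (2 * A / U) = 6 * A * ε * (U / U) by ring, div_self hU0.ne', mul_one]
      _ ≤ C * ε := by
          rw [hC]
          have he2 : (2 : ℝ) ≤ Real.exp 1 := by have := Real.add_one_le_exp (1 : ℝ); linarith
          have h3A : 3 * A * 2 ≤ 3 * A * Real.exp 1 := mul_le_mul_of_nonneg_left he2 (by positivity)
          have : 6 * A ≤ 3 * A * Real.exp 1 + 1 := by linarith
          exact mul_le_mul_of_nonneg_right this hε.le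
  -- apply the tree's theorem
  have key := HardyLittlewoodTauberianSums_holds (fun n => (n : ℝ)) c (fun n => |c n|) 0 C le_rfl
    (fun n => n.cast_nonneg) (fun n => abs_nonneg _) (fun n => neg_abs_le _) hsc hsw habel' h4 h5
  have key2 := key.comp tendsto_natCast_atTop_atTop
  refine key2.congr (fun N => ?_)
  simp only [Function.comp_apply]
  rw [Real.rpow_zero, div_one, tsum_eq_sum (s := Finset.range (N + 1)) ?_]
  · refine Finset.sum_congr rfl (fun n hn => ?_)
    rw [if_pos]
    exact_mod_cast Nat.lt_succ_iff.1 (Finset.mem_range.1 hn)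
  · intro n hn
    rw [if_neg]
    intro h
    apply hn
    rw [Finset.mem_range]
    have : n ≤ N := by exact_mod_cast h
    omega

/-- Littlewood, complex terms, general limit. -/
theorem littlewood (a : ℕ → ℂ) (s : ℂ) (hA : ∃ A : ℝ, ∀ n : ℕ, 1 ≤ n → ‖a n‖ ≤ A / n)
    (habel : Tendsto (fun r : ℝ => ∑' n : ℕ, (r : ℂ) ^ n * a n) (𝓝[<] 1) (𝓝 s)) :
    Tendsto (fun N : ℕ => ∑ n ∈ Finset.range (N + 1), a n) atTop (𝓝 s) := by
  obtain ⟨A, hA⟩ := hA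
  have hA0 : 0 ≤ A := le_trans (norm_nonneg _) (by simpa using hA 1 le_rfl)
  -- shifted sequence with Abel limit 0
  set b : ℕ → ℂ := fun n => a n - if n = 0 then s else 0 with hb
  have hb_bound : ∀ n : ℕ, 1 ≤ n → ‖b n‖ ≤ A / n := by
    intro n hn
    rw [hb]; dsimp only
    rw [if_neg (by omega), sub_zero]
    exact hA n hn
  have hsumm : ∀ r : ℝ, 0 ≤ r → r < 1 → Summable (fun n : ℕ => (r : ℂ) ^ n * a n) := by
    intro r hr0 hr1
    refine Summable.of_norm_bounded ((summable_geometric_of_lt_one hr0 hr1).mul_left (‖a 0‖ + A))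
      (fun n => ?_)
    rw [norm_mul, norm_pow, Complex.norm_real, Real.norm_of_nonneg hr0, mul_comm]
    refine mul_le_mul_of_nonneg_right ?_ (pow_nonneg hr0 n)
    rcases Nat.eq_zero_or_pos n with rfl | hn
    · linarith
    · have := hA n hn
      have h2 : A / n ≤ A := div_le_self hA0 (by exact_mod_cast hn)
      linarith [norm_nonneg (a 0)]
  have hs2 : ∀ r : ℝ, Summable (fun n : ℕ => (r : ℂ) ^ n * (if n = 0 then s else 0)) := by
    intro r
    apply summable_of_ne_finset_zero (s := {0})
    intro n hn
    rw [Finset.mem_singleton] at hn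
    simp [hn]
  have heq : ∀ (r : ℝ) (n : ℕ), (r : ℂ) ^ n * a n - (r : ℂ) ^ n * (if n = 0 then s else 0) =
      (r : ℂ) ^ n * b n := by
    intro r n; rw [hb]; dsimp only; ring
  have hsumm_b : ∀ r : ℝ, 0 ≤ r → r < 1 → Summable (fun n : ℕ => (r : ℂ) ^ n * b n) :=
    fun r hr0 hr1 => ((hsumm r hr0 hr1).sub (hs2 r)).congr (heq r)
  have habel_b : Tendsto (fun r : ℝ => ∑' n : ℕ, (r : ℂ) ^ n * b n) (𝓝[<] 1) (𝓝 0) := by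
    have h1 : Tendsto (fun r : ℝ => (∑' n : ℕ, (r : ℂ) ^ n * a n) - s) (𝓝[<] 1) (𝓝 (s - s)) :=
      habel.sub tendsto_const_nhds
    rw [sub_self] at h1
    refine h1.congr' ?_
    filter_upwards [Ioo_mem_nhdsLT (zero_lt_one' ℝ)] with r hr
    have hsingle : ∑' n : ℕ, (r : ℂ) ^ n * (if n = 0 then s else 0) = s := by
      rw [tsum_eq_single 0 (fun n hn => by simp [hn])]
      simp
    calc (∑' n : ℕ, (r : ℂ) ^ n * a n) - s
        = (∑' n : ℕ, (r : ℂ) ^ n * a n) - ∑' n : ℕ, (r : ℂ) ^ n * (if n = 0 then s else 0) := by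
          rw [hsingle]
      _ = ∑' n : ℕ, ((r : ℂ) ^ n * a n - (r : ℂ) ^ n * (if n = 0 then s else 0)) :=
          ((hsumm r hr.1.le hr.2).tsum_sub (hs2 r)).symm
      _ = ∑' n : ℕ, (r : ℂ) ^ n * b n := tsum_congr (heq r)
  -- real and imaginary parts
  have hre : Tendsto (fun N : ℕ => ∑ n ∈ Finset.range (N + 1), (b n).re) atTop (𝓝 0) := by
    refine littlewood_real_zero (fun n => (b n).re) A
      (fun n hn => (Complex.abs_re_le_norm _).trans (hb_bound n hn)) ?_
    have h := (Complex.continuous_re.tendsto 0).comp habel_b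
    simp only [Complex.zero_re] at h
    refine h.congr' ?_
    filter_upwards [Ioo_mem_nhdsLT (zero_lt_one' ℝ)] with r hr
    show (∑' n : ℕ, (r : ℂ) ^ n * b n).re = ∑' n : ℕ, (b n).re * r ^ n
    rw [Complex.re_tsum (hsumm_b r hr.1.le hr.2)]
    refine tsum_congr (fun n => ?_)
    rw [← Complex.ofReal_pow, Complex.re_ofReal_mul, mul_comm]
  have him : Tendsto (fun N : ℕ => ∑ n ∈ Finset.range (N + 1), (b n).im) atTop (𝓝 0) := by
    refine littlewood_real_zero (fun n => (b n).im) A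
      (fun n hn => (Complex.abs_im_le_norm _).trans (hb_bound n hn)) ?_
    have h := (Complex.continuous_im.tendsto 0).comp habel_b
    simp only [Complex.zero_im] at h
    refine h.congr' ?_
    filter_upwards [Ioo_mem_nhdsLT (zero_lt_one' ℝ)] with r hr
    show (∑' n : ℕ, (r : ℂ) ^ n * b n).im = ∑' n : ℕ, (b n).im * r ^ n
    rw [Complex.im_tsum (hsumm_b r hr.1.le hr.2)]
    refine tsum_congr (fun n => ?_)
    rw [← Complex.ofReal_pow, Complex.im_ofReal_mul, mul_comm]
  -- recombine
  have hb_sum : Tendsto (fun N : ℕ => ∑ n ∈ Finset.range (N + 1), b n) atTop (𝓝 0) := by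
    have h := ((Complex.continuous_ofReal.tendsto 0).comp hre).add
      (((Complex.continuous_ofReal.tendsto 0).comp him).mul (tendsto_const_nhds (x := Complex.I)))
    simp only [Function.comp_def, Complex.ofReal_zero, zero_mul, add_zero] at h
    refine h.congr (fun N => ?_)
    rw [Complex.ofReal_sum, Complex.ofReal_sum, Finset.sum_mul, ← Finset.sum_add_distrib]
    exact Finset.sum_congr rfl (fun n _ => Complex.re_add_im (b n))
  have h := hb_sum.add (tendsto_const_nhds (x := s))
  rw [zero_add] at h
  refine h.congr (fun N => ?_)
  rw [hb]; dsimp only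
  rw [Finset.sum_sub_distrib]
  simp

end Tauber

/-- **L is a theorem**: Littlewood's Tauberian theorem in the form the composition consumes. -/
theorem littlewoodTauberian : LittlewoodTauberian :=
  fun a s hA habel => Tauber.littlewood a s hA habel

/-! ### 4. The composition (kernel-checked, no `sorry`) -/

/-- **The three stubs imply the repaired crux** (Littlewood's theorem being proved in § 3b). -/
theorem TwistedGapEquationR_of (hB : Registered.stub_spinResolventIdentity)
    (hC : Registered.stub_spinSusceptibilityDiverges) (hT : Registered.stub_kernelTauberianBound) :
    TwistedGapEquationR := by
  have hL : LittlewoodTauberian := littlewoodTauberian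
  rw [repaired_iff]
  intro K hK
  -- (0) `x_c = 1/μ(ℤ²) > 0`
  have hxc : 0 < SAW.criticalFugacity := by
    have h := SAW.Zd.connectiveConstant_pos 2
    rw [SAW.Zd.connectiveConstant_two] at h
    exact inv_pos.2 h
  -- (T) the Tauberian term bound, with a nonnegative constant
  obtain ⟨A, hA⟩ := hT K hK
  set B₀ : ℝ := ‖kerCoeff K 0‖ + |A| with hB₀
  have hB₀nn : 0 ≤ B₀ := by positivity
  -- the terms `a_n := x_c^n κ_n`
  set a : ℕ → ℂ := fun n => (SAW.criticalFugacity : ℂ) ^ n * kerCoeff K n with ha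
  have hnorm_a : ∀ n : ℕ, ‖a n‖ = SAW.criticalFugacity ^ n * ‖kerCoeff K n‖ := by
    intro n
    rw [ha]
    simp only [norm_mul, norm_pow, Complex.norm_real, Real.norm_of_nonneg hxc.le]
  have ha_bound : ∀ n : ℕ, 1 ≤ n → ‖a n‖ ≤ A / n := by
    intro n hn
    rw [hnorm_a, mul_comm]
    exact hA n hn
  -- every term is dominated: `x_c^n ‖κ_n‖ ≤ B₀`
  have hterm : ∀ n : ℕ, SAW.criticalFugacity ^ n * ‖kerCoeff K n‖ ≤ B₀ := by
    intro n
    rcases Nat.eq_zero_or_pos n with rfl | hn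
    · simp only [pow_zero, one_mul, hB₀]
      linarith [abs_nonneg A]
    · have h1 : SAW.criticalFugacity ^ n * ‖kerCoeff K n‖ ≤ A / n := by
        rw [mul_comm]; exact hA n hn
      have h2 : A / n ≤ |A| := by
        have hn' : (1 : ℝ) ≤ n := by exact_mod_cast hn
        calc A / n ≤ |A| / n := by gcongr; exact le_abs_self A
          _ ≤ |A| / 1 := by gcongr
          _ = |A| := div_one _
      rw [hB₀]
      linarith [norm_nonneg (kerCoeff K 0)]
  -- below `x_c` the kernel series is absolutely summable (geometric domination)
  have hSx : ∀ x : ℝ, 0 ≤ x → x < SAW.criticalFugacity →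
      Summable (fun n : ℕ => x ^ n * ‖kerCoeff K n‖) := by
    intro x hx0 hx1
    have hq0 : 0 ≤ x / SAW.criticalFugacity := div_nonneg hx0 hxc.le
    have hq1 : x / SAW.criticalFugacity < 1 := (div_lt_one hxc).2 hx1
    refine Summable.of_nonneg_of_le (fun n => by positivity) (fun n => ?_)
      ((summable_geometric_of_lt_one hq0 hq1).mul_left B₀)
    have hx_eq : x ^ n = (x / SAW.criticalFugacity) ^ n * SAW.criticalFugacity ^ n := by
      rw [← mul_pow, div_mul_cancel₀ x hxc.ne']
    calc x ^ n * ‖kerCoeff K n‖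
        = (x / SAW.criticalFugacity) ^ n * (SAW.criticalFugacity ^ n * ‖kerCoeff K n‖) := by
          rw [hx_eq, mul_assoc]
      _ ≤ (x / SAW.criticalFugacity) ^ n * B₀ :=
          mul_le_mul_of_nonneg_left (hterm n) (pow_nonneg hq0 n)
      _ = B₀ * (x / SAW.criticalFugacity) ^ n := mul_comm _ _
  -- (B) + (C): `k(x) → 1 − x_c λ₁` along `𝓝[<] x_c` (Abel summability to the gap value)
  have hxC : Tendsto (fun x : ℝ => (x : ℂ)) (𝓝[<] SAW.criticalFugacity) (𝓝 (SAW.criticalFugacity : ℂ)) :=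
    (Complex.continuous_ofReal.tendsto _).mono_left nhdsWithin_le_nhds
  have hinv : Tendsto (fun x : ℝ => (chiGF x)⁻¹) (𝓝[<] SAW.criticalFugacity) (𝓝 0) := by
    rw [tendsto_zero_iff_norm_tendsto_zero]
    simp only [norm_inv]
    exact hC.inv_tendsto_atTop
  have hmodel : Tendsto (fun x : ℝ => 1 - (x : ℂ) * ((lam1 : ℝ) : ℂ) - (chiGF x)⁻¹)
      (𝓝[<] SAW.criticalFugacity) (𝓝 gapValue) := by
    have h1 : Tendsto (fun x : ℝ => 1 - (x : ℂ) * ((lam1 : ℝ) : ℂ)) (𝓝[<] SAW.criticalFugacity)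
        (𝓝 (1 - (SAW.criticalFugacity : ℂ) * ((lam1 : ℝ) : ℂ))) :=
      tendsto_const_nhds.sub (hxC.mul tendsto_const_nhds)
    have h2 := h1.sub hinv
    simpa [gapValue] using h2
  have hk : Tendsto (kerGF K) (𝓝[<] SAW.criticalFugacity) (𝓝 gapValue) := by
    refine hmodel.congr' (eventually_of_mem (Ioo_mem_nhdsLT hxc) fun x hx => ?_)
    obtain ⟨-, hid⟩ := hB K hK x hx.1 hx.2 (hSx x hx.1.le hx.2)
    have hinvx : (chiGF x)⁻¹ = 1 - (x : ℂ) * ((lam1 : ℝ) : ℂ) - kerGF K x :=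
      inv_eq_of_mul_eq_one_right hid
    simp only [hinvx]
    ring
  -- the substitution `x = r · x_c`: Abel means of `a_n` along `𝓝[<] 1`
  have hsub : Tendsto (fun r : ℝ => r * SAW.criticalFugacity) (𝓝[<] 1) (𝓝[<] SAW.criticalFugacity) := by
    refine tendsto_nhdsWithin_iff.2 ⟨?_, ?_⟩
    · have h := ((continuous_id.mul continuous_const).tendsto (1 : ℝ)).mono_left
        (nhdsWithin_le_nhds (s := Iio (1 : ℝ))) (f := fun r : ℝ => id r * SAW.criticalFugacity)
      simpa using h
    · filter_upwards [self_mem_nhdsWithin] with r hr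
      have : r * SAW.criticalFugacity < 1 * SAW.criticalFugacity := mul_lt_mul_of_pos_right hr hxc
      simpa using this
  have habel : Tendsto (fun r : ℝ => ∑' n : ℕ, (r : ℂ) ^ n * a n) (𝓝[<] 1) (𝓝 gapValue) := by
    have h := hk.comp hsub
    refine h.congr (fun r => ?_)
    show kerGF K (r * SAW.criticalFugacity) = ∑' n : ℕ, (r : ℂ) ^ n * a n
    unfold kerGF
    refine tsum_congr (fun n => ?_)
    rw [ha]
    simp only [Complex.ofReal_mul, mul_pow]
    ring
  -- (L) Littlewood: Abel summability + `O(1/n)` terms ⇒ convergence of the partial sums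
  have hconv := hL a gapValue ⟨A, ha_bound⟩ habel
  -- this is literally the crux's `Tendsto (partialSum K) atTop (𝓝 gapValue)`
  exact hconv

/-- Wiring check: the registered stubs feed `TwistedGapEquationR_of` as stated. -/
example : TwistedGapEquationR :=
  TwistedGapEquationR_of stub_spinResolventIdentity stub_spinSusceptibilityDiverges stub_kernelTauberianBound

/-- Axiom audit hook: the Tauberian theorem is closed (no `sorryAx`). -/
example : LittlewoodTauberian := littlewoodTauberian

end Summit.CriticalPhenomena.SAWScalingLimit.Cruxes.TwistedGapEquation.AbelLittlewood

end
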